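import Mathlib
import HarnessLib
import Literature.Probability.LatticeModels.DirInvCorrLength
import Literature.Probability.LatticeModels.IsingExponents
import Summits.CriticalPhenomena.Ising3DConformalLimit.Theses.BernsteinTemperature

/-!
# Route BernsteinTemperature, item `NuLeOne`: the three-temperature inequality forces `ν ≤ 1`

Settles item `stmt-CriticalPhenomena-8362` (support, route
`route-CriticalPhenomena-BernsteinTemperature`), exact signature:

`NuLeOne : ThreeTemperature → ∀ ν, HasIsingExponentNu 3 ν → ν ≤ 1`.

Proof (Fisher 1967 §5 / Friedli–Velenik 2017 §3.10.11 bookkeeping, as in the route card (C1) ⇒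
`ν ≤ 1`). Fix `0 < β < β_c = criticalBeta 3`. The three-temperature inequality at `β' = β_c` and
the axis site `x = n e₁` (`|x|₁ = n`), together with `⟨σ₀σ_x⟩⁺_{β_c} ≤ 1`, gives
`⟨σ₀σ_{ne₁}⟩⁺_β ≤ (tanh β / tanh β_c)ⁿ`; since `⟨σ₀σ_{ne₁}⟩⁺_β > 0` (GKS) and
`-log ⟨σ₀σ_{ne₁}⟩⁺_β / n → ξ_β(e₁)` (Fekete, `tendsto_dirInvCorrLength`), the axis inverse
correlation length obeys `ξ_β(e₁) ≥ log (tanh β_c / tanh β) ≥ 1 - tanh β / tanh β_c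
≥ (β_c - β) / (sinh β_c cosh β_c)`. Hence the tree's correlation length
`isingCorrLength 3 β = ξ_β(e₁)⁻¹` is at most `K / (β_c - β)` with `K = sinh β_c cosh β_c`, so
`log ξ(β) / log (β_c - β) ≥ log K / log (β_c - β) - 1 → -1` as `β ↑ β_c`, and the exponent
`-ν = lim log ξ(β) / log (β_c - β)` satisfies `-1 ≤ -ν`.

Tree inputs: `criticalBeta_pos_holds`, `twoPointPlus_pos`, `twoPointPlus_le_one_of_nonneg`,
`tendsto_dirInvCorrLength`, `isingCorrLength_eq_inv_dirInvCorrLength`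
(`Literature/Probability/LatticeModels/DirInvCorrLength.lean`). No named fact is taken as a
hypothesis; no definition is introduced.
-/

namespace Summit.CriticalPhenomena.Ising3DConformalLimit.Theorems

open Filter Topology
open Literature.Probability.LatticeModels
open Summit.CriticalPhenomena.Ising3DConformalLimit.Theses.BernsteinTemperature

/-- The axis site `n • e₁ ∈ ℤ³` has `ℓ¹`-norm `∑ᵢ |(n e₁)ᵢ| = n`. [folklore] -/
theorem nuLeOne_sum_natAbs_zsmul_single (n : ℕ) :
    ∑ i, (((n : ℤ) • (Pi.single (0 : Fin 3) (1 : ℤ) : Site 3)) i).natAbs = n := by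
  simp [Fin.sum_univ_three, Pi.single_apply]

/-- Elementary hyperbolic estimate: for `0 < β ≤ β'`,
`(β' - β) / (sinh β' cosh β') ≤ log (tanh β' / tanh β)` (from `log y ≥ 1 - y⁻¹`,
`tanh β' - tanh β = sinh (β' - β) / (cosh β' cosh β)`, `sinh t ≥ t` for `t ≥ 0` and
`cosh β ≤ cosh β'`). [folklore] -/
theorem nuLeOne_sub_div_le_log_tanh_div {β β' : ℝ} (hβ : 0 < β) (hββ' : β ≤ β') :
    (β' - β) / (Real.sinh β' * Real.cosh β') ≤ Real.log (Real.tanh β' / Real.tanh β) := by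
  have hβ' : 0 < β' := hβ.trans_le hββ'
  have hsβ : 0 < Real.sinh β := Real.sinh_pos_iff.2 hβ
  have hsβ' : 0 < Real.sinh β' := Real.sinh_pos_iff.2 hβ'
  have hcβ : 0 < Real.cosh β := Real.cosh_pos _
  have hcβ' : 0 < Real.cosh β' := Real.cosh_pos _
  have htβ : 0 < Real.tanh β := by
    rw [Real.tanh_eq_sinh_div_cosh]; exact div_pos hsβ hcβ
  have htβ' : 0 < Real.tanh β' := by
    rw [Real.tanh_eq_sinh_div_cosh]; exact div_pos hsβ' hcβ'
  -- `log (t'/t) ≥ 1 - t/t'`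
  have h1 : 1 - (Real.tanh β' / Real.tanh β)⁻¹ ≤ Real.log (Real.tanh β' / Real.tanh β) :=
    Real.one_sub_inv_le_log_of_pos (div_pos htβ' htβ)
  rw [inv_div] at h1
  -- `1 - t/t' = sinh (β' - β) / (sinh β' cosh β)`
  have h2 : 1 - Real.tanh β / Real.tanh β' = Real.sinh (β' - β) / (Real.sinh β' * Real.cosh β) := by
    rw [Real.tanh_eq_sinh_div_cosh, Real.tanh_eq_sinh_div_cosh, Real.sinh_sub]
    field_simp
  have h3 : β' - β ≤ Real.sinh (β' - β) := Real.self_le_sinh_iff.2 (sub_nonneg.2 hββ')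
  have h4 : Real.cosh β ≤ Real.cosh β' :=
    Real.cosh_le_cosh.2 (by rw [abs_of_pos hβ, abs_of_pos hβ']; exact hββ')
  calc (β' - β) / (Real.sinh β' * Real.cosh β')
      ≤ Real.sinh (β' - β) / (Real.sinh β' * Real.cosh β) :=
        div_le_div₀ ((sub_nonneg.2 hββ').trans h3) h3 (mul_pos hsβ' hcβ)
          (mul_le_mul_of_nonneg_left h4 hsβ'.le)
    _ = 1 - Real.tanh β / Real.tanh β' := h2.symm
    _ ≤ Real.log (Real.tanh β' / Real.tanh β) := h1

/-- **Explicit mass from the three-temperature inequality.** Under `ThreeTemperature`, for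
`0 < β < β_c(3)` the axis inverse correlation length satisfies
`log (tanh β_c / tanh β) ≤ ξ_β(e₁)`: the inequality at `β' = β_c`, `x = n e₁` with
`⟨σ₀σ_x⟩⁺_{β_c} ≤ 1` gives `⟨σ₀σ_{ne₁}⟩⁺_β ≤ (tanh β / tanh β_c)ⁿ`, and `-log ⟨σ₀σ_{ne₁}⟩⁺_β / n`
tends to `ξ_β(e₁)` (Fekete). [cite: FriedliVelenik2017, §3.10.11, p. 173] -/
theorem nuLeOne_log_tanh_div_le_dirInvCorrLength (h3T : ThreeTemperature) {β : ℝ} (hβ : 0 < β)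
    (hβc : β < criticalBeta 3) :
    Real.log (Real.tanh (criticalBeta 3) / Real.tanh β) ≤
      dirInvCorrLength 3 β (Pi.single 0 1) := by
  have hβc0 : 0 < criticalBeta 3 := criticalBeta_pos_holds (d := 3) (by norm_num)
  have htβ : 0 < Real.tanh β := by
    rw [Real.tanh_eq_sinh_div_cosh]
    exact div_pos (Real.sinh_pos_iff.2 hβ) (Real.cosh_pos _)
  have htβc : 0 < Real.tanh (criticalBeta 3) := by
    rw [Real.tanh_eq_sinh_div_cosh]
    exact div_pos (Real.sinh_pos_iff.2 hβc0) (Real.cosh_pos _)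
  refine ge_of_tendsto (tendsto_dirInvCorrLength hβ (Pi.single 0 1))
    (eventually_atTop.2 ⟨1, fun n hn => ?_⟩)
  have hn' : (0 : ℝ) < n := by exact_mod_cast hn
  rw [le_div_iff₀ hn']
  set x : Site 3 := (n : ℤ) • Pi.single (0 : Fin 3) (1 : ℤ) with hx_def
  have hx : ∑ i, (x i).natAbs = n := nuLeOne_sum_natAbs_zsmul_single n
  have h3 := h3T x β (criticalBeta 3) hβ.le hβc.le le_rfl
  rw [hx] at h3
  have hG1 : twoPointPlus 3 (criticalBeta 3) x ≤ 1 := twoPointPlus_le_one_of_nonneg hβc0.le x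
  have hGpos : 0 < twoPointPlus 3 β x := twoPointPlus_pos hβ x
  have hbound : twoPointPlus 3 β x ≤ (Real.tanh β / Real.tanh (criticalBeta 3)) ^ n := by
    rw [div_pow, le_div_iff₀ (pow_pos htβc n)]
    calc twoPointPlus 3 β x * Real.tanh (criticalBeta 3) ^ n
        ≤ twoPointPlus 3 (criticalBeta 3) x * Real.tanh β ^ n := h3
      _ ≤ 1 * Real.tanh β ^ n := mul_le_mul_of_nonneg_right hG1 (pow_nonneg htβ.le n)
      _ = Real.tanh β ^ n := one_mul _
  have hlog := Real.log_le_log hGpos hbound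
  rw [Real.log_pow, Real.log_div htβ.ne' htβc.ne'] at hlog
  rw [Real.log_div htβc.ne' htβ.ne']
  linarith

/-- **Correlation-length bound from the three-temperature inequality.** Under `ThreeTemperature`,
for `0 < β < β_c(3)` the axis correlation length of the plus state is positive and at most
`sinh β_c cosh β_c / (β_c - β)` (explicit mass `m(β) ≥ log (tanh β_c / tanh β) ≥
(β_c - β)/(sinh β_c cosh β_c)`). [cite: FriedliVelenik2017, §3.10.11, p. 173] -/
theorem nuLeOne_isingCorrLength_le (h3T : ThreeTemperature) {β : ℝ} (hβ : 0 < β)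
    (hβc : β < criticalBeta 3) :
    0 < isingCorrLength 3 β ∧
      isingCorrLength 3 β ≤
        Real.sinh (criticalBeta 3) * Real.cosh (criticalBeta 3) / (criticalBeta 3 - β) := by
  have hβc0 : 0 < criticalBeta 3 := criticalBeta_pos_holds (d := 3) (by norm_num)
  have hK : 0 < Real.sinh (criticalBeta 3) * Real.cosh (criticalBeta 3) :=
    mul_pos (Real.sinh_pos_iff.2 hβc0) (Real.cosh_pos _)
  have hm : (criticalBeta 3 - β) / (Real.sinh (criticalBeta 3) * Real.cosh (criticalBeta 3)) ≤
      dirInvCorrLength 3 β (Pi.single 0 1) :=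
    (nuLeOne_sub_div_le_log_tanh_div hβ hβc.le).trans
      (nuLeOne_log_tanh_div_le_dirInvCorrLength h3T hβ hβc)
  have hmpos : 0 < (criticalBeta 3 - β) /
      (Real.sinh (criticalBeta 3) * Real.cosh (criticalBeta 3)) :=
    div_pos (sub_pos.2 hβc) hK
  have hLpos : 0 < dirInvCorrLength 3 β (Pi.single 0 1) := hmpos.trans_le hm
  rw [isingCorrLength_eq_inv_dirInvCorrLength (d := 3) hβ.le]
  exact ⟨inv_pos.2 hLpos, (inv_anti₀ hmpos hm).trans_eq (inv_div _ _)⟩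

/-- Settles `stmt-CriticalPhenomena-8362` (exact signature): the three-temperature inequality
`ThreeTemperature` implies that every correlation-length exponent `ν` of the `ℤ³` Ising model
(`HasIsingExponentNu 3 ν`: `log ξ(β) / log (β_c - β) → -ν` as `β ↑ β_c`) satisfies `ν ≤ 1`.
From `nuLeOne_isingCorrLength_le`, `ξ(β) ≤ K/(β_c - β)` on `(0, β_c)`, so for `β_c - 1 < β < β_c`
(`log (β_c - β) < 0`) `log ξ(β) / log (β_c - β) ≥ log K / log (β_c - β) - 1 → -1`; compare the
limits. (Fisher 1967, §5: `ν` defined by `ξ ≈ (T - T_c)^{-ν}`; an explicit mass linear in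
`β_c - β` means `ν ≤ 1`.) [folklore] -/
theorem nuLeOne_proof :
    Summit.CriticalPhenomena.Ising3DConformalLimit.Theses.BernsteinTemperature.NuLeOne := by
  unfold NuLeOne
  intro h3T ν hν
  unfold HasIsingExponentNu HasLeftPowerLaw at hν
  have hβc0 : 0 < criticalBeta 3 := criticalBeta_pos_holds (d := 3) (by norm_num)
  set K : ℝ := Real.sinh (criticalBeta 3) * Real.cosh (criticalBeta 3) with hK_def
  have hK : 0 < K := mul_pos (Real.sinh_pos_iff.2 hβc0) (Real.cosh_pos _)
  -- `β_c - β → 0⁺` along `𝓝[<] β_c`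
  have hsub : Tendsto (fun β : ℝ => criticalBeta 3 - β) (𝓝[<] criticalBeta 3) (𝓝[>] 0) := by
    refine tendsto_nhdsWithin_iff.2 ⟨?_, ?_⟩
    · have h : Tendsto (fun β : ℝ => criticalBeta 3 - β) (𝓝 (criticalBeta 3))
          (𝓝 (criticalBeta 3 - criticalBeta 3)) := tendsto_const_nhds.sub tendsto_id
      rw [sub_self] at h
      exact h.mono_left nhdsWithin_le_nhds
    · filter_upwards [self_mem_nhdsWithin] with β hβ
      exact Set.mem_Ioi.2 (sub_pos.2 (Set.mem_Iio.1 hβ))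
  have hlog : Tendsto (fun β : ℝ => Real.log (criticalBeta 3 - β)) (𝓝[<] criticalBeta 3) atBot :=
    Real.tendsto_log_nhdsGT_zero.comp hsub
  -- the comparison function tends to `-1`
  have hg : Tendsto (fun β : ℝ => Real.log K / Real.log (criticalBeta 3 - β) - 1)
      (𝓝[<] criticalBeta 3) (𝓝 (0 - 1)) :=
    (tendsto_const_nhds.div_atBot hlog).sub tendsto_const_nhds
  rw [zero_sub] at hg
  -- and lies eventually below the log-ratio of the correlation length
  have hev : ∀ᶠ β in 𝓝[<] criticalBeta 3,
      Real.log K / Real.log (criticalBeta 3 - β) - 1 ≤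
        Real.log (isingCorrLength 3 β) / Real.log (criticalBeta 3 - β) := by
    have hIoo : Set.Ioo (max 0 (criticalBeta 3 - 1)) (criticalBeta 3) ∈ 𝓝[<] criticalBeta 3 :=
      Ioo_mem_nhdsLT (max_lt hβc0 (by linarith))
    filter_upwards [hIoo] with β hβ
    obtain ⟨hβl, hβu⟩ := hβ
    have hβ0 : 0 < β := (le_max_left _ _).trans_lt hβl
    have hβ1 : criticalBeta 3 - 1 < β := (le_max_right _ _).trans_lt hβl
    have hpos : 0 < criticalBeta 3 - β := sub_pos.2 hβu
    have hlt1 : criticalBeta 3 - β < 1 := by linarith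
    have hneg : Real.log (criticalBeta 3 - β) < 0 := Real.log_neg hpos hlt1
    obtain ⟨hξpos, hξle⟩ := nuLeOne_isingCorrLength_le h3T hβ0 hβu
    have hlogξ : Real.log (isingCorrLength 3 β) ≤ Real.log K - Real.log (criticalBeta 3 - β) := by
      have h := Real.log_le_log hξpos hξle
      rwa [Real.log_div hK.ne' hpos.ne'] at h
    rw [div_sub_one hneg.ne, div_le_div_right_of_neg hneg]
    exact hlogξ
  have hle : (-1 : ℝ) ≤ -ν := le_of_tendsto_of_tendsto hg hν hev
  linarith

end Summit.CriticalPhenomena.Ising3DConformalLimit.Theorems
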